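import Mathlib
import Summits.Ventures.HodgeRepro2.T5MuInvariantPadic
import Summits.Ventures.HodgeRepro2.T5MuInvariantCosets
import Summits.Ventures.HodgeRepro2.T5PadicOpenSubgroups

/-!
# T5MuInvariantPadicCosets — «μ = inf over opens» on `ℤ_p` is the infimum over the cosets `a + p^k ℤ_p`

Cell pub-hodge-repro2, Tier 5 support (seat p7; route/T5-CHECK-G-p7.md §3 S1 / S4). The prose's
μ-invariant of a measure on `Γ_𝔭 ≅ ℤ_p` is «the infimum of `v_p(m(U))` over the open (compact) subsets
`U`»; in practice one takes `U` among the standard cosets `a + p^k ℤ_p` (the «balls» of `ℤ_p`).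
T5MuInvariantPadic (p400202) defined `mu` as the infimum over all clopen sets and T5MuInvariantCosets
(p400274) showed it is the infimum over cosets of open subgroups; on `ℤ_p` the open subgroups are the
`p^k ℤ_p` (T5PadicOpenSubgroups, p400537), and this file closes the circle concretely:

* `coset a k := {x : x − a ∈ p^k ℤ_p}` — the ball `‖x − a‖ ≤ p^{−k}`, the fibre of `toZModPow k` through `a`;
  `isClopen_coset`, `coset_eq_of_mem`, `coset_antitone`;
* `exists_forall_coset_subset`: a clopen `U ⊆ ℤ_p` is UNIFORMLY open — `∃ K, ∀ x ∈ U, coset x K ⊆ U`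
  (compactness);
* `exists_finset_indicatorCM_eq_sum`: `1_U = Σ_{x ∈ s} 1_{coset x K}` for a finite set `s ⊆ U` of
  representatives (one per residue class mod `p^K` met by `U`);
* `mu_eq_iInf_coset`: `mu p m = ⨅ (k : ℕ) (a : ℤ_p), v_p(m(1_{a + p^k ℤ_p}))` — «inf over opens = inf over
  the standard cosets», for every linear functional `m` (no bound needed).

Mathlib + own T5MuInvariantPadic, T5MuInvariantCosets (its `iInf_vp_le_vp_sum`), T5PadicOpenSubgroups only.
-/

namespace Summit.Ventures.HodgeRepro2.T5MuInvariantPadicCosets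

open PadicInt Filter Topology Metric
open Summit.Ventures.HodgeRepro2.T5MeasureSupOnClopens
open Summit.Ventures.HodgeRepro2.T5MuInvariantPadic
open Summit.Ventures.HodgeRepro2.T5MuInvariantCosets
open Summit.Ventures.HodgeRepro2.T5PadicOpenSubgroups

variable {p : ℕ} [hp : Fact p.Prime]

/-! ### The cosets `a + p^k ℤ_p` -/

/-- The coset `a + p^k ℤ_p = {x : x − a ∈ (p^k)}`. -/
def coset (a : ℤ_[p]) (k : ℕ) : Set ℤ_[p] := {x | x - a ∈ Ideal.span {(p : ℤ_[p]) ^ k}}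

/-- Membership. -/
theorem mem_coset_iff {a x : ℤ_[p]} {k : ℕ} : x ∈ coset a k ↔ x - a ∈ Ideal.span {(p : ℤ_[p]) ^ k} :=
  Iff.rfl

/-- `coset a k` is the closed ball `‖x − a‖ ≤ p^{−k}`. -/
theorem mem_coset_iff_norm {a x : ℤ_[p]} {k : ℕ} : x ∈ coset a k ↔ ‖x - a‖ ≤ (p : ℝ) ^ (-(k : ℤ)) :=
  (norm_le_pow_iff_mem_span_pow (x - a) k).symm

/-- `coset a k` is the fibre of `toZModPow k` through `a`. -/
theorem mem_coset_iff_toZModPow {a x : ℤ_[p]} {k : ℕ} :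
    x ∈ coset a k ↔ toZModPow k x = toZModPow k a := by
  rw [mem_coset_iff, ← ker_toZModPow, RingHom.mem_ker, map_sub, sub_eq_zero]

/-- `a ∈ coset a k`. -/
theorem self_mem_coset (a : ℤ_[p]) (k : ℕ) : a ∈ coset a k := by
  rw [mem_coset_iff, sub_self]
  exact Submodule.zero_mem _

/-- Two cosets of `p^k ℤ_p` that meet are equal. -/
theorem coset_eq_of_mem {a x : ℤ_[p]} {k : ℕ} (hx : x ∈ coset a k) : coset x k = coset a k := by
  ext y
  rw [mem_coset_iff, mem_coset_iff]
  rw [mem_coset_iff] at hx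
  constructor
  · intro hy
    have := Submodule.add_mem _ hy hx
    rwa [sub_add_sub_cancel] at this
  · intro hy
    have := Submodule.sub_mem _ hy hx
    rwa [sub_sub_sub_cancel_right] at this

/-- `coset a l ⊆ coset a k` for `k ≤ l`. -/
theorem coset_antitone {a : ℤ_[p]} {k l : ℕ} (hkl : k ≤ l) : coset a l ⊆ coset a k := by
  intro x hx
  rw [mem_coset_iff] at hx ⊢
  refine Ideal.span_singleton_le_span_singleton.mpr ?_ hx
  exact pow_dvd_pow _ hkl

/-- The cosets are clopen (translates of the open — hence closed — subgroup `p^k ℤ_p`). -/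
theorem isClopen_coset (a : ℤ_[p]) (k : ℕ) : IsClopen (coset a k) := by
  have hopen : IsOpen ((Ideal.span {(p : ℤ_[p]) ^ k} : Ideal ℤ_[p]) : Set ℤ_[p]) := isOpen_span_pow k
  have hclosed : IsClosed ((Ideal.span {(p : ℤ_[p]) ^ k} : Ideal ℤ_[p]) : Set ℤ_[p]) :=
    AddSubgroup.isClosed_of_isOpen (Submodule.toAddSubgroup (Ideal.span {(p : ℤ_[p]) ^ k})) hopen
  have hcont : Continuous fun x : ℤ_[p] => x - a := continuous_id.sub continuous_const
  exact ⟨hclosed.preimage hcont, hopen.preimage hcont⟩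

/-- `coset a k ∈ 𝓝 a`. -/
theorem coset_mem_nhds (a : ℤ_[p]) (k : ℕ) : coset a k ∈ 𝓝 a :=
  (isClopen_coset a k).isOpen.mem_nhds (self_mem_coset a k)

/-- A small coset lies in a small ball: `coset a k ⊆ ball a ε` once `p^{−k} < ε`. -/
theorem coset_subset_ball {a : ℤ_[p]} {k : ℕ} {ε : ℝ} (h : (p : ℝ) ^ (-(k : ℤ)) < ε) :
    coset a k ⊆ ball a ε := by
  intro x hx
  rw [mem_coset_iff_norm] at hx
  rw [mem_ball, dist_eq_norm]
  exact lt_of_le_of_lt hx h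

/-- Some `p^{−k}` is below any `ε > 0`. -/
theorem exists_pow_neg_lt {ε : ℝ} (hε : 0 < ε) : ∃ k : ℕ, (p : ℝ) ^ (-(k : ℤ)) < ε := by
  have hp1 : (1 : ℝ) < p := by exact_mod_cast hp.out.one_lt
  have hinv : (p : ℝ)⁻¹ < 1 := inv_lt_one_of_one_lt₀ hp1
  obtain ⟨k, hk⟩ := exists_pow_lt_of_lt_one hε hinv
  refine ⟨k, ?_⟩
  rw [zpow_neg, zpow_natCast, ← inv_pow]
  exact hk

/-! ### Clopen sets are uniformly open, and finite unions of cosets -/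

/-- A clopen `U ⊆ ℤ_p` is UNIFORMLY open: some `K` works for every point — `coset x K ⊆ U` for all
`x ∈ U` (compactness of `U`). -/
theorem exists_forall_coset_subset {U : Set ℤ_[p]} (hU : IsClopen U) :
    ∃ K : ℕ, ∀ x ∈ U, coset x K ⊆ U := by
  classical
  -- a radius for every point
  have hloc : ∀ x : ℤ_[p], x ∈ U → ∃ k : ℕ, coset x k ⊆ U := by
    intro x hx
    obtain ⟨ε, hε, hball⟩ := Metric.mem_nhds_iff.mp (hU.isOpen.mem_nhds hx)
    obtain ⟨k, hk⟩ := exists_pow_neg_lt (p := p) hε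
    exact ⟨k, (coset_subset_ball hk).trans hball⟩
  choose! k hk using hloc
  -- finitely many cosets cover the compact `U`
  obtain ⟨t, htU, hcover⟩ :=
    hU.isClosed.isCompact.elim_nhds_subcover (fun x : ℤ_[p] => coset x (k x))
      fun x _ => coset_mem_nhds x (k x)
  refine ⟨t.sup k, fun y hy => ?_⟩
  obtain ⟨x, hxt, hyx⟩ := Set.mem_iUnion₂.mp (hcover hy)
  calc coset y (t.sup k) ⊆ coset y (k x) := coset_antitone (Finset.le_sup hxt)
    _ = coset x (k x) := coset_eq_of_mem hyx
    _ ⊆ U := hk x (htU x hxt)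

/-- Representatives: for a clopen `U` and a uniform level `K`, the indicator `1_U` is the sum of the
indicators of the cosets `coset x K`, `x` running over a finite set of representatives in `U`, one per
residue class mod `p^K` met by `U`. -/
theorem exists_finset_indicator_eq_sum {U : Set ℤ_[p]} (hU : IsClopen U) :
    ∃ (K : ℕ) (s : Finset ℤ_[p]), (∀ x ∈ s, x ∈ U) ∧
      ∀ z : ℤ_[p], U.indicator (1 : ℤ_[p] → ℤ_[p]) z =
        ∑ x ∈ s, (coset x K).indicator (1 : ℤ_[p] → ℤ_[p]) z := by
  classical
  obtain ⟨K, hK⟩ := exists_forall_coset_subset hU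
  let r : ℤ_[p] → ZMod (p ^ K) := toZModPow K
  let met : Finset (ZMod (p ^ K)) := Finset.univ.filter fun c => ∃ y ∈ U, r y = c
  have hrep : ∀ c ∈ met, ∃ y ∈ U, r y = c := fun c hc => (Finset.mem_filter.mp hc).2
  choose! rep hrepU hrepr using hrep
  refine ⟨K, met.image rep, ?_, ?_⟩
  · intro x hx
    obtain ⟨c, hc, rfl⟩ := Finset.mem_image.mp hx
    exact hrepU c hc
  · intro z
    by_cases hz : z ∈ U
    · -- exactly the representative of the class of `z` contributes
      have hmet : r z ∈ met := Finset.mem_filter.mpr ⟨Finset.mem_univ _, z, hz, rfl⟩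
      have hzmem : z ∈ coset (rep (r z)) K := by
        rw [mem_coset_iff_toZModPow]
        exact (hrepr _ hmet).symm
      rw [Set.indicator_of_mem hz, Finset.sum_image, Finset.sum_eq_single (r z)]
      · rw [Set.indicator_of_mem hzmem]
      · intro c hc hne
        rw [Set.indicator_of_notMem]
        intro hzc
        rw [mem_coset_iff_toZModPow] at hzc
        apply hne
        rw [← hrepr c hc]
        exact hzc.symm
      · intro h
        exact absurd hmet h
      · -- `rep` is injective on `met` (distinct classes have distinct representatives)
        intro c hc c' hc' h
        rw [← hrepr c hc, ← hrepr c' hc', h]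
    · -- no coset of a representative contains `z` (they all lie in `U`)
      rw [Set.indicator_of_notMem hz]
      symm
      refine Finset.sum_eq_zero fun x hx => ?_
      obtain ⟨c, hc, rfl⟩ := Finset.mem_image.mp hx
      rw [Set.indicator_of_notMem]
      intro hzc
      exact hz (hK _ (hrepU c hc) hzc)

/-- The same identity in `C(ℤ_p, ℤ_p)`: `indicatorCM U = Σ_{x ∈ s} indicatorCM (coset x K)`. -/
theorem exists_finset_indicatorCM_eq_sum {U : Set ℤ_[p]} (hU : IsClopen U) :
    ∃ (K : ℕ) (s : Finset ℤ_[p]), (∀ x ∈ s, x ∈ U) ∧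
      (indicatorCM U : C(ℤ_[p], ℤ_[p])) = ∑ x ∈ s, indicatorCM (coset x K) := by
  obtain ⟨K, s, hs, h⟩ := exists_finset_indicator_eq_sum hU
  refine ⟨K, s, hs, ?_⟩
  ext z
  rw [indicatorCM_apply hU, ContinuousMap.coe_sum, Finset.sum_apply, h z]
  exact Finset.sum_congr rfl fun x _ => (indicatorCM_apply (isClopen_coset x K) z).symm

/-! ### «μ = inf over the standard cosets» -/

/-- The μ-invariant as the infimum over the standard cosets. -/
noncomputable def muStd (m : C(ℤ_[p], ℤ_[p]) →ₗ[ℤ_[p]] ℤ_[p]) : ℕ∞ :=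
  ⨅ (k : ℕ) (a : ℤ_[p]), vp p (m (indicatorCM (coset a k)))

/-- `muStd m ≤ v_p(m(1_{a + p^k ℤ_p}))`. -/
theorem muStd_le (m : C(ℤ_[p], ℤ_[p]) →ₗ[ℤ_[p]] ℤ_[p]) (k : ℕ) (a : ℤ_[p]) :
    muStd m ≤ vp p (m (indicatorCM (coset a k))) := by
  unfold muStd
  exact iInf_le_of_le k (iInf_le _ a)

/-- «μ = inf over opens = inf over the standard cosets»: `mu p m = muStd m` for every `m`
(`≤` since the cosets are clopen; `≥` since every clopen set is a finite disjoint union of cosets of one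
`p^K ℤ_p` and the valuation of a finite sum is at least the infimum of the valuations). -/
theorem mu_eq_muStd (m : C(ℤ_[p], ℤ_[p]) →ₗ[ℤ_[p]] ℤ_[p]) : mu p m = muStd m := by
  apply le_antisymm
  · exact le_iInf₂ fun k a => mu_le p m (isClopen_coset a k)
  · refine le_iInf fun U => ?_
    obtain ⟨K, s, -, h⟩ := exists_finset_indicatorCM_eq_sum U.2
    rw [h, map_sum]
    refine le_trans ?_ (iInf_vp_le_vp_sum p s fun x => m (indicatorCM (coset x K)))
    exact le_iInf fun x => le_iInf fun _ => muStd_le m K x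

/-- The explicit form: `mu p m = ⨅ (k : ℕ) (a : ℤ_p), v_p(m(1_{a + p^k ℤ_p}))`. -/
theorem mu_eq_iInf_coset (m : C(ℤ_[p], ℤ_[p]) →ₗ[ℤ_[p]] ℤ_[p]) :
    mu p m = ⨅ (k : ℕ) (a : ℤ_[p]), vp p (m (indicatorCM (coset a k))) :=
  mu_eq_muStd m

/-- `k ≤ μ(m)` iff `p^k` divides every `m(1_{a + p^l ℤ_p})`. -/
theorem natCast_le_mu_iff (m : C(ℤ_[p], ℤ_[p]) →ₗ[ℤ_[p]] ℤ_[p]) (k : ℕ) :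
    (k : ℕ∞) ≤ mu p m ↔ ∀ (l : ℕ) (a : ℤ_[p]), (k : ℕ∞) ≤ vp p (m (indicatorCM (coset a l))) := by
  rw [mu_eq_iInf_coset]
  simp only [le_iInf_iff]

end Summit.Ventures.HodgeRepro2.T5MuInvariantPadicCosets
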